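/-
Copyright (c) 2026 the pub-hodgecm-mathlib formalisation cell (harness21).  Prover seat hodgecm-mathlib-F0P2-p01 (g11), programme P2,
row R3 ∕ (a′) of the desk's CENSUS-OCCGEN-B2 (`F0/P2/CENSUS-OCCGEN-B2.F0P2-plan-g12.md` §2 (a′), §5) for the OCC♭-GEN line (stub Θ-OCC-GEN
`StubThetaOccursInGen`), 2026-09-01.  KERNEL module: THEOREMS ONLY (no definition, no named fact, no `sorry`, no instance, no notation).
-/
import Literature.NumberTheory.Automorphic.Liu2021.Def411WeilCarriersAtLineClassTransportAllFrames   -- ★ `lineClassTransport_equiv`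
import Summits.HodgeConjecture.HodgeConjecture.Theorems.H413AdmissibleLineSign                     -- ★ `AdmissibleLine.epsOf_eq_locF_mk0`
import Literature.RepresentationTheory.Liu2021.OscillatorConventions                               -- ★ `isOscillatorChar_toHeckeCharacter_iff`
import HarnessLib

/-!
# FLOOR-0 P2 · R3 «THE ADMISSIBLE REPRESENTATIVE AND THE LINE TRANSPORT OF Θ-OCC-GEN's `∃ θ`-CLAUSE» (CENSUS-OCCGEN-B2 §2 (a′), §5)

Cell hodgecm-mathlib (D-0151), FLOOR 0; crux item H413 = stmt-HodgeConjecture-24833 (route `HCCMUnconditional`, no route verbs); programme P2, the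
OCC♭-GEN pay-down line of OCC♭∀ (`Cruxes/H413/Lines/F0_P2OccFlatGeneral.lean` ED. 1 v2 d4b61ff8c7817f4a, ONE letter Θ-OCC-GEN `StubThetaOccursInGen`).
Desk F0P2-plan (g12)'s CENSUS-OCCGEN-B2 §2 runs the theta ENGINE at the ADMISSIBLE REPRESENTATIVE `a′ = e · 2δ_L` of the collection `locF a`
(`hadm : ∃ e, IsAdmissibleElement L Φ_μ e ∧ epsOf (2δ_L)⁻¹ e = locF a`), never at `a`, and pulls the result back to `a` along the ★ line-class transport
`ω(a,χ) ≃ ω(a′,χ)` (★ `Def411WeilCarriers.lineClassTransport_equiv`, [Liu2021, Def. 4.11–4.12]: the carrier depends on the line only through its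
collection).  THIS FILE is that glue (R3 of the census, S-sized, ★-composable), in the letter's own currency:
* §1 **`exists_admissibleUnit_of_hadm`** — from `hadm`: an admissible `e` and a unit `a′ ∈ (L⁺)ˣ` with `(a′ : L) = e · (2 · imagUnit L)` (P4's `hae`
  convention) and `locF a′ = locF a` (★ `AdmissibleLine.epsOf_eq_locF_mk0`).
* §2 **`thetaOccursInClause_of_locF_eq`** — for ANY rank `N`, any `ιV : U(H)(𝔸_{L⁺,f}) →* U(diag dV)(𝔸_{L⁺,f})`, any submodule `A` of `ℂ²`-valued
  functions and any two lines with `locF a = locF a′`: the `∃ θ`-clause of Θ-OCC-GEN («`∃ θ : omegaAtLine … a χ →ₗ[ℂ] (U(H)(𝔸) → ℂ²), θ ≠ 0 ∧ (∀ w, θ w ∈ A) ∧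
  ∀ k w, θ (rhoAtLine … ιV a χ k w) = fun x ↦ θ w (x * k_𝔸)`») TRANSPORTS from `a′` to `a` (`θ := θ′ ∘ Ψ`, `Ψ` the ★ equivariant linear equivalence).
* §3 **`thetaOccursInClause_of_admissibleRepresentative`** — §1 + §2: to prove the clause at `(a, χ)` under `hadm` it suffices to prove it at
  `(a′, χ)` for every admissible `e` with `a′ = e · 2δ_L`.
THEOREMS ONLY; `--supports stmt-HodgeConjecture-24833`.  HONEST LABEL: HC_CM is proved only modulo the printed citations until rung 0 closes; this file
closes NO print letter.

## References
* [Liu2021] Y. Liu, *Fourier–Jacobi cycles and arithmetic relative trace formula*, Camb. J. Math. 9 (2021) = arXiv:2102.11518, Def. 4.11 (l. 2090–2096),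
  Def. 4.12 (l. 2102–2108), App. D §D.1 Step 1 footnote (l. 5215), Steps 2–3.
* [GelbartRogawski1991] S. Gelbart, J. Rogawski, Invent. Math. 105 (1991), §3.1 Prop. 3.1.1 p. 455; Remark p. 457.
* [MoeglinVignerasWaldspurger1987] C. Mœglin, M.-F. Vignéras, J.-L. Waldspurger, LNM 1291, Chap. 3 I.1–I.3.
-/

set_option autoImplicit false

-- the mandated namespace has the single-problem summit's repeated segment (`HodgeConjecture.HodgeConjecture`)
set_option linter.dupNamespace false

noncomputable section

open NumberField IsDedekindDomain
open scoped Matrix ComplexOrder Classical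

namespace Summit.HodgeConjecture.HodgeConjecture.Cruxes.H413.F0P2sThetaOccursInLineTransport

open Literature.NumberTheory.Automorphic Literature.NumberTheory.Automorphic.UnitaryGroup
open Literature.NumberTheory.Automorphic.IdeleClassGroup
open Literature.NumberTheory.Automorphic.Liu2021
open Literature.NumberTheory.Automorphic.Liu2021.Def411WeilCarriers
open Literature.NumberTheory.Automorphic.Liu2021.Def411WeilCarriersDoubling
open Literature.NumberTheory.GelbartRogawski1991 Literature.NumberTheory.GelbartRogawski1991.UnitaryDualPair
open Literature.AlgebraicGeometry.Liu2021 (IsAdmissibleElement)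
open Literature.RepresentationTheory.Liu2021
open Summit.HodgeConjecture.HodgeConjecture.Cruxes.H413

/-! ## §1 The admissible representative `a′ = e · 2δ_L` of the collection `locF a` -/

/-- **The admissible representative.**  If the collection of the line `⟨a⟩` is `μ`-admissible in the letter's sense (`∃ e`, `e` admissible for the CM type
`Φ`, `epsOf (2·imagUnit L)⁻¹ e = locF a`), then there are an admissible `e` and a unit `a′ ∈ (L⁺)ˣ` with `(a′ : L) = e · (2 · imagUnit L)` — P4's convention
`hae` — and `locF a′ = locF a` (★ `AdmissibleLine.epsOf_eq_locF_mk0`: the collection of `e` IS the collection of the real unit `e · 2δ_L`).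
[cite: Liu2021, Def. 4.12 (l. 2102–2108)] -/
theorem exists_admissibleUnit_of_hadm (L : Type) [Field L] [NumberField L] [IsCMField L] (Φ : Set (L →+* ℂ))
    (a : (↥(maximalRealSubfield L))ˣ)
    (hadm : ∃ e : L, IsAdmissibleElement L Φ e ∧
      epsOf (↥(maximalRealSubfield L)) (imagUnitSq L) L (2 * imagUnit L)⁻¹ e = locF (↥(maximalRealSubfield L)) (imagUnitSq L) a) :
    ∃ (e : L) (_ : IsAdmissibleElement L Φ e) (a' : (↥(maximalRealSubfield L))ˣ),
      ((a' : ↥(maximalRealSubfield L)) : L) = e * (2 * imagUnit L) ∧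
        locF (↥(maximalRealSubfield L)) (imagUnitSq L) a' = locF (↥(maximalRealSubfield L)) (imagUnitSq L) a := by
  obtain ⟨e, he, heps⟩ := hadm
  refine ⟨e, he, Units.mk0 ⟨e * (2 * imagUnit L), AdmissibleLine.lineScalar_mem (complexConj_imagUnit L) he.2.1⟩
    (AdmissibleLine.lineScalar_subtype_ne_zero (complexConj_imagUnit L) (imagUnit_ne_zero L) he.2.1 he.1), rfl, ?_⟩
  rw [← AdmissibleLine.epsOf_eq_locF_mk0 (imagUnitSq L) (complexConj_imagUnit L) (imagUnit_ne_zero L) he.2.1 he.1]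
  exact heps

/-! ## §2 Transport of the `∃ θ`-clause along the line-class equivalence `ω(a,χ) ≃ ω(a′,χ)` -/

section Transport

variable (L : Type) [Field L] [NumberField L] [IsCMField L] (N : ℕ) (H : Matrix (Fin N) (Fin N) L)
  {n' : ℕ} (e₁ : Fin N × Fin 1 ≃ Fin n') (dV : Fin N → L) (hdV : ∀ i, IsCMField.complexConj L (dV i) = dV i)
  (hdV0 : ∀ i, dV i ≠ 0)
  (ιV : finAdelic (↥(maximalRealSubfield L)) L (IsCMField.complexConj L) N H →*
    finAdelic (↥(maximalRealSubfield L)) L (IsCMField.complexConj L) N (Matrix.diagonal dV))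
  (μ : Literature.NumberTheory.Automorphic.IdeleClassGroup L →ₜ* Circle) (hμ : IsConjugateSymplectic L μ)
  (χ : Chi (↥(maximalRealSubfield L)) L (IsCMField.complexConj L))
  (A : Submodule ℂ ((adelicGroupData (↥(maximalRealSubfield L)) L (IsCMField.complexConj L) N H).Adelic → (Fin 2 → ℂ)))

set_option maxHeartbeats 1600000 in
/-- **LINE TRANSPORT of Θ-OCC-GEN's `∃ θ`-clause.**  If `locF a = locF a′` and the clause holds at `(a′, χ)` — a NON-ZERO `ρ(a′,χ)`-equivariant (for right
translation by `U(H)(𝔸_{L⁺,f})`) linear `θ′ : omegaAtLine … a′ χ → (U(H)(𝔸_{L⁺}) → ℂ²)` with values in `A` — then it holds at `(a, χ)`: `θ := θ′ ∘ Ψ` for the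
★ equivariant linear equivalence `Ψ : ω(a,χ) ≃ ω(a′,χ)` of `lineClassTransport_equiv` ([Liu2021, Def. 4.11–4.12]: the carrier `ω(μ, ε, χ)` depends on the
line only through its collection `ε = locF a`).  Any rank `N`, any `ιV`, any `A`.
[cite: Liu2021, Def. 4.11 (l. 2092–2096); Def. 4.12; App. D §D.1 Step 1 footnote (l. 5215)] [cite: GelbartRogawski1991, §3.1 Prop. 3.1.1 p. 455; Remark p. 457]
[cite: MoeglinVignerasWaldspurger1987, Chap. 3 I.1–I.3] -/
theorem thetaOccursInClause_of_locF_eq (a a' : (↥(maximalRealSubfield L))ˣ)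
    (hloc : locF (↥(maximalRealSubfield L)) (imagUnitSq L) a = locF (↥(maximalRealSubfield L)) (imagUnitSq L) a')
    (h' : ∃ θ' : omegaAtLine (↥(maximalRealSubfield L)) L (IsCMField.complexConj L) N e₁ (Matrix.diagonal dV)
          (complexConj_imagUnit L) (imagUnit_ne_zero L) (imagUnit_mul_self L) (realDiagonal_isSymm L dV hdV)
          (isUnit_det_realDiagonal L dV hdV hdV0) (realDiagonal_map L dV hdV).symm
          (fun b => isCompatible_chiSplittingLine L e₁ dV hdV hdV0 (toHeckeCharacter L μ)
            (isUnitary_toHeckeCharacter L μ) ((isOscillatorChar_toHeckeCharacter_iff μ).mpr hμ)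
            (TW (↥(maximalRealSubfield L)) b) (isSymm_TW (↥(maximalRealSubfield L)) b)
            (isUnit_det_TW (↥(maximalRealSubfield L)) b) (JW (↥(maximalRealSubfield L)) L b)
            (JW_eq (↥(maximalRealSubfield L)) L b)) a' χ →ₗ[ℂ]
        ((adelicGroupData (↥(maximalRealSubfield L)) L (IsCMField.complexConj L) N H).Adelic → (Fin 2 → ℂ)),
      θ' ≠ 0 ∧ (∀ w, θ' w ∈ A) ∧
        ∀ (k : finAdelic (↥(maximalRealSubfield L)) L (IsCMField.complexConj L) N H) (w),
          θ' (rhoAtLine (↥(maximalRealSubfield L)) L (IsCMField.complexConj L) N e₁ (Matrix.diagonal dV)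
              (complexConj_imagUnit L) (imagUnit_ne_zero L) (imagUnit_mul_self L) (realDiagonal_isSymm L dV hdV)
              (isUnit_det_realDiagonal L dV hdV hdV0) (realDiagonal_map L dV hdV).symm
              (fun b => isCompatible_chiSplittingLine L e₁ dV hdV hdV0 (toHeckeCharacter L μ)
                (isUnitary_toHeckeCharacter L μ) ((isOscillatorChar_toHeckeCharacter_iff μ).mpr hμ)
                (TW (↥(maximalRealSubfield L)) b) (isSymm_TW (↥(maximalRealSubfield L)) b)
                (isUnit_det_TW (↥(maximalRealSubfield L)) b) (JW (↥(maximalRealSubfield L)) L b)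
                (JW_eq (↥(maximalRealSubfield L)) L b)) ιV a' χ k w) =
            fun x => θ' w (x * finAdelicToAdelic (↥(maximalRealSubfield L)) L (IsCMField.complexConj L) N H k)) :
    ∃ θ : omegaAtLine (↥(maximalRealSubfield L)) L (IsCMField.complexConj L) N e₁ (Matrix.diagonal dV)
          (complexConj_imagUnit L) (imagUnit_ne_zero L) (imagUnit_mul_self L) (realDiagonal_isSymm L dV hdV)
          (isUnit_det_realDiagonal L dV hdV hdV0) (realDiagonal_map L dV hdV).symm
          (fun b => isCompatible_chiSplittingLine L e₁ dV hdV hdV0 (toHeckeCharacter L μ)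
            (isUnitary_toHeckeCharacter L μ) ((isOscillatorChar_toHeckeCharacter_iff μ).mpr hμ)
            (TW (↥(maximalRealSubfield L)) b) (isSymm_TW (↥(maximalRealSubfield L)) b)
            (isUnit_det_TW (↥(maximalRealSubfield L)) b) (JW (↥(maximalRealSubfield L)) L b)
            (JW_eq (↥(maximalRealSubfield L)) L b)) a χ →ₗ[ℂ]
        ((adelicGroupData (↥(maximalRealSubfield L)) L (IsCMField.complexConj L) N H).Adelic → (Fin 2 → ℂ)),
      θ ≠ 0 ∧ (∀ w, θ w ∈ A) ∧
        ∀ (k : finAdelic (↥(maximalRealSubfield L)) L (IsCMField.complexConj L) N H) (w),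
          θ (rhoAtLine (↥(maximalRealSubfield L)) L (IsCMField.complexConj L) N e₁ (Matrix.diagonal dV)
              (complexConj_imagUnit L) (imagUnit_ne_zero L) (imagUnit_mul_self L) (realDiagonal_isSymm L dV hdV)
              (isUnit_det_realDiagonal L dV hdV hdV0) (realDiagonal_map L dV hdV).symm
              (fun b => isCompatible_chiSplittingLine L e₁ dV hdV hdV0 (toHeckeCharacter L μ)
                (isUnitary_toHeckeCharacter L μ) ((isOscillatorChar_toHeckeCharacter_iff μ).mpr hμ)
                (TW (↥(maximalRealSubfield L)) b) (isSymm_TW (↥(maximalRealSubfield L)) b)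
                (isUnit_det_TW (↥(maximalRealSubfield L)) b) (JW (↥(maximalRealSubfield L)) L b)
                (JW_eq (↥(maximalRealSubfield L)) L b)) ιV a χ k w) =
            fun x => θ w (x * finAdelicToAdelic (↥(maximalRealSubfield L)) L (IsCMField.complexConj L) N H k) := by
  obtain ⟨θ', hne', hA', heqv'⟩ := h'
  obtain ⟨Ψ, hΨ⟩ := lineClassTransport_equiv L e₁ dV hdV hdV0 (toHeckeCharacter L μ) (isUnitary_toHeckeCharacter L μ)
    ((isOscillatorChar_toHeckeCharacter_iff μ).mpr hμ) χ a a' hloc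
  refine ⟨θ' ∘ₗ Ψ.toLinearMap, fun h0 => hne' ?_, fun w => hA' (Ψ w), fun k w => ?_⟩
  · -- `θ' = (θ' ∘ Ψ) ∘ Ψ⁻¹ = 0`
    refine LinearMap.ext fun w => ?_
    have := congrArg (fun f : _ →ₗ[ℂ] _ => f (Ψ.symm w)) h0
    simpa only [LinearMap.coe_comp, Function.comp_apply, LinearEquiv.coe_coe, LinearEquiv.apply_symm_apply,
      LinearMap.zero_apply] using this
  · -- equivariance: `ρ(a,χ) k = ρ_V(a,χ) (ιV k)`, `Ψ` intertwines `ρ_V(a,χ)` with `ρ_V(a′,χ)`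
    show θ' (Ψ (rhoVAtLine (↥(maximalRealSubfield L)) L (IsCMField.complexConj L) N e₁ (Matrix.diagonal dV)
        (complexConj_imagUnit L) (imagUnit_ne_zero L) (imagUnit_mul_self L) (realDiagonal_isSymm L dV hdV)
        (isUnit_det_realDiagonal L dV hdV hdV0) (realDiagonal_map L dV hdV).symm
        (fun b => isCompatible_chiSplittingLine L e₁ dV hdV hdV0 (toHeckeCharacter L μ)
          (isUnitary_toHeckeCharacter L μ) ((isOscillatorChar_toHeckeCharacter_iff μ).mpr hμ)
          (TW (↥(maximalRealSubfield L)) b) (isSymm_TW (↥(maximalRealSubfield L)) b)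
          (isUnit_det_TW (↥(maximalRealSubfield L)) b) (JW (↥(maximalRealSubfield L)) L b)
          (JW_eq (↥(maximalRealSubfield L)) L b)) a χ (ιV k) w)) =
      fun x => θ' (Ψ w) (x * finAdelicToAdelic (↥(maximalRealSubfield L)) L (IsCMField.complexConj L) N H k)
    rw [hΨ (ιV k) w]
    exact heqv' k (Ψ w)

end Transport

/-! ## §3 The clause at `(a, χ)` from the clause at every admissible representative -/

section Admissible

variable (L : Type) [Field L] [NumberField L] [IsCMField L] (N : ℕ) (H : Matrix (Fin N) (Fin N) L)
  {n' : ℕ} (e₁ : Fin N × Fin 1 ≃ Fin n') (dV : Fin N → L) (hdV : ∀ i, IsCMField.complexConj L (dV i) = dV i)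
  (hdV0 : ∀ i, dV i ≠ 0)
  (ιV : finAdelic (↥(maximalRealSubfield L)) L (IsCMField.complexConj L) N H →*
    finAdelic (↥(maximalRealSubfield L)) L (IsCMField.complexConj L) N (Matrix.diagonal dV))
  (μ : Literature.NumberTheory.Automorphic.IdeleClassGroup L →ₜ* Circle) (hμ : IsConjugateSymplectic L μ)
  (χ : Chi (↥(maximalRealSubfield L)) L (IsCMField.complexConj L))
  (A : Submodule ℂ ((adelicGroupData (↥(maximalRealSubfield L)) L (IsCMField.complexConj L) N H).Adelic → (Fin 2 → ℂ)))

set_option maxHeartbeats 1600000 in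
/-- **Θ-OCC-GEN's `∃ θ`-clause at `(a, χ)` FROM THE ADMISSIBLE REPRESENTATIVES** (CENSUS-OCCGEN-B2 §2 composition order «hadm ↦ (a′) ↦ … ↦ pull back»):
under the letter's admissibility hypothesis `hadm` for the CM type `Φ` (the letter: `Φ = hμ.cmType.1`), if the clause holds at `(a′, χ)` for EVERY admissible
`e` and unit `a′` with `(a′ : L) = e · (2 · imagUnit L)`, then it holds at `(a, χ)`.  [cite: Liu2021, Def. 4.11 (l. 2092–2096); Def. 4.12 (l. 2102–2108)]
[cite: GelbartRogawski1991, §3.1 Prop. 3.1.1 p. 455; Remark p. 457] -/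
theorem thetaOccursInClause_of_admissibleRepresentative (Φ : Set (L →+* ℂ)) (a : (↥(maximalRealSubfield L))ˣ)
    (hadm : ∃ e : L, IsAdmissibleElement L Φ e ∧
      epsOf (↥(maximalRealSubfield L)) (imagUnitSq L) L (2 * imagUnit L)⁻¹ e = locF (↥(maximalRealSubfield L)) (imagUnitSq L) a)
    (h' : ∀ (e : L), IsAdmissibleElement L Φ e → ∀ (a' : (↥(maximalRealSubfield L))ˣ),
      ((a' : ↥(maximalRealSubfield L)) : L) = e * (2 * imagUnit L) →
      ∃ θ' : omegaAtLine (↥(maximalRealSubfield L)) L (IsCMField.complexConj L) N e₁ (Matrix.diagonal dV)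
          (complexConj_imagUnit L) (imagUnit_ne_zero L) (imagUnit_mul_self L) (realDiagonal_isSymm L dV hdV)
          (isUnit_det_realDiagonal L dV hdV hdV0) (realDiagonal_map L dV hdV).symm
          (fun b => isCompatible_chiSplittingLine L e₁ dV hdV hdV0 (toHeckeCharacter L μ)
            (isUnitary_toHeckeCharacter L μ) ((isOscillatorChar_toHeckeCharacter_iff μ).mpr hμ)
            (TW (↥(maximalRealSubfield L)) b) (isSymm_TW (↥(maximalRealSubfield L)) b)
            (isUnit_det_TW (↥(maximalRealSubfield L)) b) (JW (↥(maximalRealSubfield L)) L b)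
            (JW_eq (↥(maximalRealSubfield L)) L b)) a' χ →ₗ[ℂ]
        ((adelicGroupData (↥(maximalRealSubfield L)) L (IsCMField.complexConj L) N H).Adelic → (Fin 2 → ℂ)),
      θ' ≠ 0 ∧ (∀ w, θ' w ∈ A) ∧
        ∀ (k : finAdelic (↥(maximalRealSubfield L)) L (IsCMField.complexConj L) N H) (w),
          θ' (rhoAtLine (↥(maximalRealSubfield L)) L (IsCMField.complexConj L) N e₁ (Matrix.diagonal dV)
              (complexConj_imagUnit L) (imagUnit_ne_zero L) (imagUnit_mul_self L) (realDiagonal_isSymm L dV hdV)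
              (isUnit_det_realDiagonal L dV hdV hdV0) (realDiagonal_map L dV hdV).symm
              (fun b => isCompatible_chiSplittingLine L e₁ dV hdV hdV0 (toHeckeCharacter L μ)
                (isUnitary_toHeckeCharacter L μ) ((isOscillatorChar_toHeckeCharacter_iff μ).mpr hμ)
                (TW (↥(maximalRealSubfield L)) b) (isSymm_TW (↥(maximalRealSubfield L)) b)
                (isUnit_det_TW (↥(maximalRealSubfield L)) b) (JW (↥(maximalRealSubfield L)) L b)
                (JW_eq (↥(maximalRealSubfield L)) L b)) ιV a' χ k w) =
            fun x => θ' w (x * finAdelicToAdelic (↥(maximalRealSubfield L)) L (IsCMField.complexConj L) N H k)) :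
    ∃ θ : omegaAtLine (↥(maximalRealSubfield L)) L (IsCMField.complexConj L) N e₁ (Matrix.diagonal dV)
          (complexConj_imagUnit L) (imagUnit_ne_zero L) (imagUnit_mul_self L) (realDiagonal_isSymm L dV hdV)
          (isUnit_det_realDiagonal L dV hdV hdV0) (realDiagonal_map L dV hdV).symm
          (fun b => isCompatible_chiSplittingLine L e₁ dV hdV hdV0 (toHeckeCharacter L μ)
            (isUnitary_toHeckeCharacter L μ) ((isOscillatorChar_toHeckeCharacter_iff μ).mpr hμ)
            (TW (↥(maximalRealSubfield L)) b) (isSymm_TW (↥(maximalRealSubfield L)) b)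
            (isUnit_det_TW (↥(maximalRealSubfield L)) b) (JW (↥(maximalRealSubfield L)) L b)
            (JW_eq (↥(maximalRealSubfield L)) L b)) a χ →ₗ[ℂ]
        ((adelicGroupData (↥(maximalRealSubfield L)) L (IsCMField.complexConj L) N H).Adelic → (Fin 2 → ℂ)),
      θ ≠ 0 ∧ (∀ w, θ w ∈ A) ∧
        ∀ (k : finAdelic (↥(maximalRealSubfield L)) L (IsCMField.complexConj L) N H) (w),
          θ (rhoAtLine (↥(maximalRealSubfield L)) L (IsCMField.complexConj L) N e₁ (Matrix.diagonal dV)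
              (complexConj_imagUnit L) (imagUnit_ne_zero L) (imagUnit_mul_self L) (realDiagonal_isSymm L dV hdV)
              (isUnit_det_realDiagonal L dV hdV hdV0) (realDiagonal_map L dV hdV).symm
              (fun b => isCompatible_chiSplittingLine L e₁ dV hdV hdV0 (toHeckeCharacter L μ)
                (isUnitary_toHeckeCharacter L μ) ((isOscillatorChar_toHeckeCharacter_iff μ).mpr hμ)
                (TW (↥(maximalRealSubfield L)) b) (isSymm_TW (↥(maximalRealSubfield L)) b)
                (isUnit_det_TW (↥(maximalRealSubfield L)) b) (JW (↥(maximalRealSubfield L)) L b)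
                (JW_eq (↥(maximalRealSubfield L)) L b)) ιV a χ k w) =
            fun x => θ w (x * finAdelicToAdelic (↥(maximalRealSubfield L)) L (IsCMField.complexConj L) N H k) := by
  obtain ⟨e, he, a', ha', hloc⟩ := exists_admissibleUnit_of_hadm L Φ a hadm
  exact thetaOccursInClause_of_locF_eq L N H e₁ dV hdV hdV0 ιV μ hμ χ A a a' hloc.symm (h' e he a' ha')

end Admissible

end Summit.HodgeConjecture.HodgeConjecture.Cruxes.H413.F0P2sThetaOccursInLineTransport

end
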